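import Literature.MathematicalPhysics.QuantumFieldTheory.Balaban1983to89.B2Sect3C

/-!
# `Balaban1983to89.B2Ineq347SeqCount` — [Balaban1982Higgs2] Sect. 3.C p. 593, the UNPRINTED step (3.46) ⇒ (3.47)
# *"After easy transformations we get"*, part 1/3: the SUM → SUP inequality and the SEQUENCE COUNT (entropy of the
# admissible sequences of unions of large blocks) that pays for it — PROVED; this is where the weight `1 + log(Lᵏε)⁻¹`
# of (3.47) comes from

statement-level skeleton of published theorems with citation tags; proofs where landed; nothing here is a claim about the Yang–Mills mass gap

PDF held: `paper:balaban1982-cmp86-higgs23-ii` (T. Bałaban, *(Higgs)₂,₃ quantum fields in a finite volume. II. An upper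
bound*, Commun. Math. Phys. **86** (1982) 555–594 [Balaban1982Higgs2]; journal page = PDF page + 554); pp. 592–594
[PDF 38–40] READ AS IMAGES on `run/shared/lean/pub/pub-balaban/b2b-balaban-ref1/pages/1982-cmp86-higgs23-II/
1982-cmp86-higgs23-II-p038-x2.png`, `…-p039-x2.png`, `…-p040-x2.png`, with pp. 557–559, 566 [PDF 3–5, 12] (p(ε), (2.7)–(2.8),
(2.13)–(2.15), "admissible") and part I p. 607 [PDF 5 of `1982-cmp85-higgs23-I`] ((1.19)–(1.21): blocks, large blocks = cubes
of side `ML`, `|Λ|` = number of points on the unit lattice).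

CITATION HEADER (lean-in-tree rule).  Cell `lit-balaban` (HOME `run/shared/lean/pub/lit-balaban/`), Phase-2 proof seat
**p23** gen 8 (unit `lit-balaban-p23-g8`); SKELETON rows **B2.Eq3.42** ((3.41)–(3.42) p. 592 + proviso p. 594; decl of
record `B2.Claim342Printed`) and **B2.Eq3.47** ((3.43)–(3.54) pp. 592–594; decls `B2Sect3C.Leaf347`, `Bound350`, …);
fold owner r02, second reader r14, referee ref-4.  Located gap of record: cell `pub-balaban` GAPS.md **G-pv04-3**
(items (i) SUM → SUP, (ii) COLLARS, (iii) the k = K terms and the origin of the weight `1 + log(Lᵏε)⁻¹`), which asks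
verbatim for *"a proof of `B2Sect3C.Leaf347 P ρ X A B` … from (3.42)'s left side + (3.46) + a STATED sequence-count
lemma (i) + STATED collar bounds (ii)"*.  This file is part 1 of 3 (`B2Ineq347SeqCount` → `B2Ineq347SumToSup` → `B2Ineq342From346`) and works over the
carriers of `…Balaban1983to89.B2` (`Params`, `Run`) and `…Balaban1983to89.B2Sect3C` (`CData`, `epsK`, `xk`, `one_le_xk`),
used BY NAME; nothing of another seat is restated; no definition is introduced (theorems only).

WHAT IS PRINTED (p. 593 [PDF 39], verbatim).  *"From (3.41) we have  ζ″_{Λ₀⁽ᵏ⁾} ≤ Σ_{{P_v⁽ᵏ⁾,…,R_s⁽ᵏ⁾} admissible,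
minimal} exp(−c₀p(Lᵏε)²|𝒞_k|) ≤ Σ_{all the subsets of Λ₀⁽ᵏ⁾ᶜ} exp(−c₀p(Lᵏε)²|𝒞_k|) = 2^{6|Λ₀⁽ᵏ⁾ᶜ|}exp(−c₀p(Lᵏε)²|𝒞_k|),
k = 0, 1, …, K − 1.  (3.46)  After easy transformations we get  (the left side of (3.42)) ≤ sup_{{Λ₀⁽⁰⁾,…,Λ⁽ᴷ⁻¹⁾}
admissible} ·exp(−Σ_{k=0}^{K−1} c₀p(Lᵏε)²|𝒞_k|) ·exp(Σ_{k=0}^{K−1} O(1)(1 + log(Lᵏε)⁻¹)|Λ₀⁽ᵏ⁾ᶜ|) ·exp(O(1)|T₁⁽ᴷ⁾|).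
(3.47)  In the second exponent we have gathered all the expressions dependent on Λ₀⁽ᵏ⁾ᶜ. The third exponent has the
required form and can be omitted in further considerations."*  The left side of (3.42) (p. 592) is the SUM
`Σ_{Λ₀⁽⁰⁾,…,Λ₀⁽ᴷ⁻¹⁾} Π_{k=0}^{K−1} ζ″_{Λ₀⁽ᵏ⁾} · exp(Σ_{k=0}^{K} O(1)(Lᵏε)^{κ₀}|Λ₇⁽ᵏ⁻¹⁾′ ∩ Λ₇⁽ᵏ⁾ᶜ|) ·
exp(Σ_{k=0}^{K} O(1)|Λ₅⁽ᵏ⁻¹⁾′ ∩ Λ₅⁽ᵏ⁾ᶜ|)` (`B2.lhs342`); p. 566 [PDF 12]: *"The sets are unions of big blocks"*.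

THE MECHANISM MADE EXPLICIT (G-pv04-3 (i), (iii)).  Write `F(s)` for the summand of (3.42) at the admissible sequence
`s`, `x_k = 1 + log(Lᵏε)⁻¹` (`B2Sect3C.xk`), and `w(s) = Π_{k<K} e^{−θx_k|Λ₀⁽ᵏ⁾ᶜ|(s)}` (θ > 0 fixed).  (i) SUM → SUP:
`Σ_s F(s) = Σ_s w(s)·(F(s)/w(s)) ≤ (Σ_s w(s)) · sup_s F(s)/w(s)` (§1, `sum_le_iSup_of_weights`); the factor
`1/w(s) = exp(Σ_k θx_k|Λ₀⁽ᵏ⁾ᶜ|)` IS the printed middle exponent of (3.47) with its weight `1 + log(Lᵏε)⁻¹` — the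
logarithm is the price of the sequence count (G-pv04-3 (iii)).  THE SEQUENCE COUNT (§2): the sets `Λ₀⁽ᵏ⁾ᶜ` are unions
of large blocks of `T₁⁽ᵏ⁾` (p. 566, (2.7)), a large block holds `m = (LM)ᵈ` points (part I p. 607), so summing `w` over
ALL tuples `(W₀, …, W_{K−1})` of sets of large blocks over-counts the admissible sequences and gives
`Σ_s w(s) ≤ Π_k (1 + e^{−θx_km})^{#blocks_k} ≤ exp(Σ_k #blocks_k · e^{−θx_km})` (`sum_piFinset_prod_pow_card`,
`sum_prod_exp_le_of_injective`), and `e^{−θx_km} = e^{−θm}(Lᵏε)^{θm}` (`exp_neg_xk_mul`) beats the block count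
`#blocks_k ≤ (Lᵏε)^{−d}·(Lᴷε)ᵈ·|T₁⁽ᴷ⁾|/m` as soon as `θm ≥ d + 1`: `Σ_{k<K} #blocks_k e^{−θx_km} ≤ |T₁⁽ᴷ⁾|/m`
(`blockCount_weight_sum_le`; `Σ_{k<K} Lᵏε ≤ Lᴷε ≤ 1` for `L ≥ 2`) — the third exponent `exp(O(1)|T₁⁽ᴷ⁾|)` of (3.47).
(Cell GAPS G-pv04-3 suggests an alternative weight, half of each small factor of (3.41); the large-block weight used here
is the one that reproduces the printed shape of (3.47).)

WHAT IS KERNEL-CHECKED (zero `sorry`, no `def`; axioms standard).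
 §1 `sum_le_iSup_of_weights` (the sum → sup inequality (i)).
 §2 `sum_powerset_pow_card`, `sum_piFinset_prod_pow_card` (`Σ_{(W_k)} Π_k a_k^{|W_k|} = Π_k (1 + a_k)^{#B_k}`),
    `add_one_pow_le_exp_mul`, **`sum_prod_exp_le_of_injective`** (the count for any finite family of sequences INJECTING
    into tuples of block sets, entropy volume ≥ m·#blocks), `sum_range_pow_le`, `exp_neg_xk_mul`,
    **`blockCount_weight_sum_le`** (`Σ_{k<K}N_k e^{−θx_km} ≤ |T₁⁽ᴷ⁾|/m`), and, over the run carrier,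
    **`entropy_of_blocks`**: `Σ_s Π_{k<K} e^{−θx_k|Λ₀⁽ᵏ⁾ᶜ|(s)} ≤ e^{|T₁⁽ᴷ⁾|/m}` for every run whose sequences inject into
    tuples of large-block sets with `|Λ₀⁽ᵏ⁾ᶜ| ≥ m·#blocks`, `#B_k·m·(Lᵏε)ᵈ ≤ |T₁⁽ᴷ⁾|·(Lᴷε)ᵈ`, `θm ≥ d + 1`, `L ≥ 2`,
    `Lᴷε ≤ 1` — the sequence-count HYPOTHESIS of parts 2–3 discharged.

HONEST SCOPE.  (a) Carriers are the abstract ones of `B2`/`B2Sect3C` (`Run`, `CData` are pure data); the block structure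
enters `entropy_of_blocks` as an explicit injection with explicit counting hypotheses — the identification with the
sequences of p. 566 of a concrete multi-scale region model is not made here (single-scale concrete regions: typer g8
`B2Eq28RegionsConcrete`; multi-scale sequences: not in the tree).  (b) Value = the counting half of the located
unprinted step of a passage two later papers import by reference ("model independent", B10 p. 274; "the same
combinatorics", B14 p. 264), made into kernel-checked lemmas with every input named; NOT summit progress.
-/

namespace Literature.MathematicalPhysics.QuantumFieldTheory.Balaban1983to89.B2Ineq347SeqCount

open Finset
open Literature.MathematicalPhysics.QuantumFieldTheory.Balaban1983to89
open Literature.MathematicalPhysics.QuantumFieldTheory.Balaban1983to89.B2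
open Literature.MathematicalPhysics.QuantumFieldTheory.Balaban1983to89.B2Sect3C

/-! ## §1. SUM → SUP (G-pv04-3 (i)): `Σ_s F(s) ≤ sup_s F(s)/w(s) · Σ_s w(s)` in the form used below -/

/-- The sum → sup step behind *"After easy transformations we get (the left side of (3.42)) ≤ sup …"* (3.47): over a
finite index set, if `F(s)·Σ_t w(t) ≤ R(s)·w(s)` for positive weights `w`, then `Σ_s F(s) ≤ sup_s R(s)` (for an empty
index both sides are 0). (Folklore: weighted sum-to-sup.) [cite: Balaban1982Higgs2, (3.47) p.593] -/
theorem sum_le_iSup_of_weights {ι : Type*} [Fintype ι] (F w R : ι → ℝ) (hw : ∀ i, 0 < w i)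
    (h : ∀ i, F i * ∑ j, w j ≤ R i * w i) : ∑ i, F i ≤ ⨆ i, R i := by
  rcases isEmpty_or_nonempty ι with hι | hι
  · simp
  · have hS : 0 < ∑ j, w j := Finset.sum_pos (fun j _ => hw j) Finset.univ_nonempty
    have hbdd : BddAbove (Set.range R) := (Set.finite_range R).bddAbove
    have hsup : ∀ i, R i ≤ ⨆ i, R i := fun i => le_ciSup hbdd i
    have hF : ∀ i, F i ≤ (⨆ i, R i) * w i / ∑ j, w j := by
      intro i
      rw [le_div_iff₀ hS]
      calc F i * ∑ j, w j ≤ R i * w i := h i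
        _ ≤ (⨆ i, R i) * w i := mul_le_mul_of_nonneg_right (hsup i) (hw i).le
    calc ∑ i, F i ≤ ∑ i, (⨆ i, R i) * w i / ∑ j, w j := Finset.sum_le_sum fun i _ => hF i
      _ = (⨆ i, R i) * (∑ i, w i) / ∑ j, w j := by rw [← Finset.sum_div, Finset.mul_sum]
      _ = ⨆ i, R i := by rw [mul_div_assoc, div_self hS.ne', mul_one]

/-! ## §2. THE SEQUENCE COUNT (G-pv04-3 (i), (iii)): tuples of unions of large blocks -/

/-- `Σ_{t ⊆ s} a^{|t|} = (a + 1)^{|s|}` (binomial theorem over the powerset). [folklore] -/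
private theorem sum_powerset_pow_card {α : Type*} (s : Finset α) (a : ℝ) :
    ∑ t ∈ s.powerset, a ^ t.card = (a + 1) ^ s.card := by
  rw [← Finset.sum_pow_mul_eq_add_pow a 1 s]
  exact Finset.sum_congr rfl fun t _ => by rw [one_pow, mul_one]

/-- The generating identity of the sequence count: summing `Π_k a_k^{|W_k|}` over ALL tuples `(W_k)_{k<K}` of subsets of
the finite block sets `B_k` gives `Π_k (a_k + 1)^{#B_k}`. (Folklore: product of binomial sums,
`Finset.prod_univ_sum`.) [cite: Balaban1982Higgs2, (3.47) p.593] -/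
theorem sum_piFinset_prod_pow_card {K : ℕ} (B : Fin K → Type*) [∀ k, Fintype (B k)] [∀ k, DecidableEq (B k)]
    (a : Fin K → ℝ) :
    ∑ W ∈ Fintype.piFinset (fun k => (Finset.univ : Finset (B k)).powerset), ∏ k, a k ^ (W k).card
      = ∏ k, (a k + 1) ^ Fintype.card (B k) := by
  symm
  calc ∏ k, (a k + 1) ^ Fintype.card (B k)
      = ∏ k, ∑ W ∈ (Finset.univ : Finset (B k)).powerset, a k ^ W.card := by
        refine Finset.prod_congr rfl fun k _ => ?_
        rw [sum_powerset_pow_card, Finset.card_univ]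
    _ = _ := Finset.prod_univ_sum _ _

/-- `(a + 1)ⁿ ≤ e^{na}` for `a ≥ 0`. [folklore] -/
private theorem add_one_pow_le_exp_mul {a : ℝ} (ha : 0 ≤ a) (n : ℕ) : (a + 1) ^ n ≤ Real.exp (n * a) := by
  calc (a + 1) ^ n ≤ (Real.exp a) ^ n := pow_le_pow_left₀ (by linarith) (Real.add_one_le_exp a) n
    _ = Real.exp (n * a) := by rw [← Real.exp_nat_mul]

/-- **The sequence count.**  Let the finite family `Seq` of sequences INJECT into the tuples `(W_k)_{k<K}` of sets of
large blocks (`W_k ⊆ B_k`; p. 566: *"The sets are unions of big blocks"*), and let the entropy volume dominate the block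
count, `m·|W_k(s)| ≤ v_k(s)` (a large block holds `m = (LM)ᵈ` points, part I p. 607).  Then for weights `c_k ≥ 0`,
`Σ_s Π_k e^{−c_k v_k(s)} ≤ exp(Σ_k #B_k · e^{−c_k m})` — by over-counting with ALL tuples,
`Π_k (1 + e^{−c_km})^{#B_k} ≤ exp(Σ_k #B_k e^{−c_km})`. (Folklore: binomial over-count.) [cite: Balaban1982Higgs2, (3.47) p.593, p.566] -/
theorem sum_prod_exp_le_of_injective {K : ℕ} {B : Fin K → Type*} [∀ k, Fintype (B k)] [∀ k, DecidableEq (B k)]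
    {Seq : Type*} [Fintype Seq] (ι : Seq → ∀ k : Fin K, Finset (B k)) (hι : Function.Injective ι)
    (c : Fin K → ℝ) (hc : ∀ k, 0 ≤ c k) (m : ℝ) (v : Fin K → Seq → ℝ)
    (hv : ∀ s k, m * ((ι s k).card : ℝ) ≤ v k s) :
    ∑ s, ∏ k, Real.exp (-(c k * v k s))
      ≤ Real.exp (∑ k, (Fintype.card (B k) : ℝ) * Real.exp (-(c k * m))) := by
  classical
  -- step 1: each term is bounded by the block-count monomial of its tuple
  have h1 : ∀ s, ∏ k, Real.exp (-(c k * v k s)) ≤ ∏ k, Real.exp (-(c k * m)) ^ (ι s k).card := by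
    intro s
    refine Finset.prod_le_prod (fun k _ => (Real.exp_pos _).le) fun k _ => ?_
    rw [← Real.exp_nat_mul]
    apply Real.exp_le_exp.mpr
    have hk := mul_le_mul_of_nonneg_left (hv s k) (hc k)
    have : ((ι s k).card : ℝ) * -(c k * m) = -(c k * (m * ((ι s k).card : ℝ))) := by ring
    rw [this]
    exact neg_le_neg hk
  -- step 2: over-count by all tuples of block sets
  have h2 : ∑ s, ∏ k, Real.exp (-(c k * m)) ^ (ι s k).card
      ≤ ∑ W ∈ Fintype.piFinset (fun k => (Finset.univ : Finset (B k)).powerset),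
          ∏ k, Real.exp (-(c k * m)) ^ (W k).card := by
    have himg : ∑ W ∈ (Finset.univ : Finset Seq).image ι, ∏ k, Real.exp (-(c k * m)) ^ (W k).card
        = ∑ s, ∏ k, Real.exp (-(c k * m)) ^ (ι s k).card :=
      Finset.sum_image (f := fun W => ∏ k, Real.exp (-(c k * m)) ^ (W k).card) fun x _ y _ hxy => hι hxy
    rw [← himg]
    refine Finset.sum_le_sum_of_subset_of_nonneg (fun W _ => ?_) fun W _ _ => ?_
    · exact Fintype.mem_piFinset.mpr fun k => Finset.mem_powerset.mpr (Finset.subset_univ _)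
    · exact Finset.prod_nonneg fun k _ => pow_nonneg (Real.exp_pos _).le _
  calc ∑ s, ∏ k, Real.exp (-(c k * v k s))
      ≤ ∑ s, ∏ k, Real.exp (-(c k * m)) ^ (ι s k).card := Finset.sum_le_sum fun s _ => h1 s
    _ ≤ _ := h2
    _ = ∏ k, (Real.exp (-(c k * m)) + 1) ^ Fintype.card (B k) :=
        sum_piFinset_prod_pow_card B fun k => Real.exp (-(c k * m))
    _ ≤ ∏ k, Real.exp ((Fintype.card (B k) : ℝ) * Real.exp (-(c k * m))) :=
        Finset.prod_le_prod (fun k _ => pow_nonneg (by positivity) _)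
          fun k _ => add_one_pow_le_exp_mul (Real.exp_pos _).le _
    _ = Real.exp (∑ k, (Fintype.card (B k) : ℝ) * Real.exp (-(c k * m))) := by rw [Real.exp_sum]

/-- `Σ_{k<K} Lᵏ ≤ Lᴷ − 1` for `L ≥ 2`. [folklore] -/
private theorem sum_range_pow_le {L : ℝ} (hL : 2 ≤ L) (K : ℕ) : ∑ k ∈ range K, L ^ k ≤ L ^ K - 1 := by
  induction K with
  | zero => simp
  | succ K ih =>
    rw [Finset.sum_range_succ, pow_succ]
    have hLK : 0 ≤ L ^ K := pow_nonneg (by linarith) K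
    nlinarith

/-- WHERE THE WEIGHT `1 + log(Lᵏε)⁻¹` COMES FROM (G-pv04-3 (iii)): with `x_k = 1 + log(Lᵏε)⁻¹`,
`e^{−θx_km} = e^{−θm}·(Lᵏε)^{θm}` — a logarithmic weight per point is a POWER of the scale per block.
(Folklore: `Real.rpow_def_of_pos`.) [cite: Balaban1982Higgs2, (3.47) p.593] -/
theorem exp_neg_xk_mul (P : Params) (ρ : Run) (hL : 0 < (P.L : ℝ)) (hε : 0 < ρ.ε) (θ m : ℝ) (k : ℕ) :
    Real.exp (-(θ * xk P ρ k * m)) = Real.exp (-(θ * m)) * epsK P ρ k ^ (θ * m) := by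
  have hpos : 0 < epsK P ρ k := by unfold epsK; positivity
  rw [Real.rpow_def_of_pos hpos, ← Real.exp_add]
  congr 1
  unfold xk
  rw [Real.log_inv]
  ring

/-- **The scale arithmetic of the sequence count.**  If the block counts `N_k` satisfy
`N_k·m·(Lᵏε)ᵈ ≤ |T₁⁽ᴷ⁾|·(Lᴷε)ᵈ` (k < K: `#blocks × points per block = #T₁⁽ᵏ⁾`, and `#T₁⁽ᵏ⁾·(Lᵏε)ᵈ` is the
scale-independent physical volume), `θm ≥ d + 1`, `m > 0`, `L ≥ 2`, `Lᴷε ≤ 1`, then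
`Σ_{k<K} N_k e^{−θx_km} ≤ |T₁⁽ᴷ⁾|/m` (each term is `≤ (|T₁⁽ᴷ⁾|/m)·Lᵏε` and `Σ_{k<K}Lᵏε ≤ Lᴷε ≤ 1`) — the third exponent
`exp(O(1)|T₁⁽ᴷ⁾|)` of (3.47). (Folklore: real arithmetic.) [cite: Balaban1982Higgs2, (3.47) p.593] -/
theorem blockCount_weight_sum_le (P : Params) (ρ : Run) (X : CData ρ) {m θ : ℝ} (N : ℕ → ℝ)
    (hL : 2 ≤ (P.L : ℝ)) (hε : 0 < ρ.ε) (hK1 : epsK P ρ ρ.K ≤ 1) (hm : 0 < m)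
    (hθm : (P.d : ℝ) + 1 ≤ θ * m) (hN0 : ∀ k, k < ρ.K → 0 ≤ N k)
    (hN : ∀ k, k < ρ.K → N k * m * epsK P ρ k ^ P.d ≤ (X.volTK : ℝ) * epsK P ρ ρ.K ^ P.d) :
    ∑ k ∈ range ρ.K, N k * Real.exp (-(θ * xk P ρ k * m)) ≤ (X.volTK : ℝ) / m := by
  have hL0 : 0 < (P.L : ℝ) := by linarith
  have hL1 : 1 ≤ (P.L : ℝ) := by linarith
  have hεk : ∀ k, 0 < epsK P ρ k := fun k => by unfold epsK; positivity
  have hεk1 : ∀ k, k ≤ ρ.K → epsK P ρ k ≤ 1 := by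
    intro k hk
    refine le_trans ?_ hK1
    unfold epsK
    exact mul_le_mul_of_nonneg_right (pow_le_pow_right₀ hL1 hk) hε.le
  have hKd : epsK P ρ ρ.K ^ P.d ≤ 1 := pow_le_one₀ (hεk ρ.K).le (hεk1 ρ.K le_rfl)
  have hT : 0 ≤ (X.volTK : ℝ) := Nat.cast_nonneg _
  -- each term ≤ (volTK/m) · Lᵏε
  have hterm : ∀ k ∈ range ρ.K,
      N k * Real.exp (-(θ * xk P ρ k * m)) ≤ (X.volTK : ℝ) / m * epsK P ρ k := by
    intro k hk
    have hk' := mem_range.mp hk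
    have hx := hεk k
    -- e^{−θ x_k m} = e^{−θm}(Lᵏε)^{θm} ≤ (Lᵏε)^{d+1}
    have h1 : Real.exp (-(θ * xk P ρ k * m)) ≤ epsK P ρ k ^ (P.d + 1) := by
      rw [exp_neg_xk_mul P ρ hL0 hε θ m k]
      have hθm0 : Real.exp (-(θ * m)) ≤ 1 := by
        rw [Real.exp_le_one_iff]
        have : 0 ≤ θ * m := le_trans (by positivity) hθm
        linarith
      have hpow : epsK P ρ k ^ (θ * m) ≤ epsK P ρ k ^ (P.d + 1) := by
        have := Real.rpow_le_rpow_of_exponent_ge hx (hεk1 k hk'.le) hθm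
        rw [show ((P.d : ℝ) + 1) = ((P.d + 1 : ℕ) : ℝ) from (Nat.cast_succ P.d).symm, Real.rpow_natCast] at this
        exact this
      calc Real.exp (-(θ * m)) * epsK P ρ k ^ (θ * m) ≤ 1 * epsK P ρ k ^ (P.d + 1) :=
            mul_le_mul hθm0 hpow (Real.rpow_nonneg hx.le _) zero_le_one
        _ = epsK P ρ k ^ (P.d + 1) := one_mul _
    -- N_k (Lᵏε)^{d+1} = (N_k (Lᵏε)^d)·Lᵏε ≤ (volTK (Lᴷε)^d / m)·Lᵏε ≤ (volTK/m)·Lᵏε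
    have h2 : N k * epsK P ρ k ^ P.d ≤ (X.volTK : ℝ) / m := by
      rw [le_div_iff₀ hm]
      calc N k * epsK P ρ k ^ P.d * m = N k * m * epsK P ρ k ^ P.d := by ring
        _ ≤ (X.volTK : ℝ) * epsK P ρ ρ.K ^ P.d := hN k hk'
        _ ≤ (X.volTK : ℝ) * 1 := mul_le_mul_of_nonneg_left hKd hT
        _ = (X.volTK : ℝ) := mul_one _
    calc N k * Real.exp (-(θ * xk P ρ k * m)) ≤ N k * epsK P ρ k ^ (P.d + 1) :=
          mul_le_mul_of_nonneg_left h1 (hN0 k hk')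
      _ = N k * epsK P ρ k ^ P.d * epsK P ρ k := by rw [pow_succ]; ring
      _ ≤ (X.volTK : ℝ) / m * epsK P ρ k := mul_le_mul_of_nonneg_right h2 hx.le
  -- Σ_{k<K} Lᵏε ≤ Lᴷε ≤ 1
  have hgeo : ∑ k ∈ range ρ.K, epsK P ρ k ≤ 1 := by
    have hs : ∑ k ∈ range ρ.K, epsK P ρ k = (∑ k ∈ range ρ.K, (P.L : ℝ) ^ k) * ρ.ε := by
      rw [Finset.sum_mul]; rfl
    rw [hs]
    have hg := sum_range_pow_le hL ρ.K
    calc (∑ k ∈ range ρ.K, (P.L : ℝ) ^ k) * ρ.ε ≤ ((P.L : ℝ) ^ ρ.K - 1) * ρ.ε :=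
          mul_le_mul_of_nonneg_right hg hε.le
      _ ≤ (P.L : ℝ) ^ ρ.K * ρ.ε := by nlinarith
      _ ≤ 1 := hK1
  calc ∑ k ∈ range ρ.K, N k * Real.exp (-(θ * xk P ρ k * m))
      ≤ ∑ k ∈ range ρ.K, (X.volTK : ℝ) / m * epsK P ρ k := Finset.sum_le_sum hterm
    _ = (X.volTK : ℝ) / m * ∑ k ∈ range ρ.K, epsK P ρ k := by rw [Finset.mul_sum]
    _ ≤ (X.volTK : ℝ) / m * 1 := mul_le_mul_of_nonneg_left hgeo (by positivity)
    _ = (X.volTK : ℝ) / m := mul_one _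

/-! ### The sequence count over the run carrier of `B2`/`B2Sect3C` -/

/-- **The sequence-count hypothesis of parts 2–3 (`B2Ineq347SumToSup`, `B2Ineq342From346`) holds** (with `E = 1/m`) for every run whose admissible sequences INJECT
into the tuples `(W_k)_{k<K}` of sets of large blocks of the lattices `T₁⁽ᵏ⁾` (p. 566: *"The sets are unions of big
blocks"*; a sequence is determined by its sets `Λ₀⁽ᵏ⁾ᶜ`), with `|Λ₀⁽ᵏ⁾ᶜ| ≥ m·#W_k` (a large block holds `m = (LM)ᵈ`
points, part I p. 607), block counts `#B_k·m·(Lᵏε)ᵈ ≤ |T₁⁽ᴷ⁾|·(Lᴷε)ᵈ` (`#B_k·m ≤ #T₁⁽ᵏ⁾` and the scale-free physical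
volume `#T₁⁽ᵏ⁾(Lᵏε)ᵈ`), `θm ≥ d + 1`, `L ≥ 2` and the stopping rule `Lᴷε ≤ 1`:
`Σ_s Π_{k<K} e^{−θ(1+log(Lᵏε)⁻¹)|Λ₀⁽ᵏ⁾ᶜ|(s)} ≤ e^{|T₁⁽ᴷ⁾|/m}`. [cite: Balaban1982Higgs2, (3.47) p.593, p.566] -/
theorem entropy_of_blocks (P : Params) (ρ : Run) (X : CData ρ)
    (B : Fin ρ.K → Type*) [∀ k, Fintype (B k)] [∀ k, DecidableEq (B k)]
    (ι : ρ.Seq → ∀ k : Fin ρ.K, Finset (B k)) (hι : Function.Injective ι) {m θ : ℝ}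
    (hL : 2 ≤ (P.L : ℝ)) (hε : 0 < ρ.ε) (hK1 : epsK P ρ ρ.K ≤ 1) (hm : 0 < m) (hθ : 0 ≤ θ)
    (hθm : (P.d : ℝ) + 1 ≤ θ * m)
    (hv : ∀ s (k : Fin ρ.K), m * ((ι s k).card : ℝ) ≤ (X.vol0c k s : ℝ))
    (hN : ∀ k : Fin ρ.K,
      (Fintype.card (B k) : ℝ) * m * epsK P ρ k ^ P.d ≤ (X.volTK : ℝ) * epsK P ρ ρ.K ^ P.d) :
    (letI := ρ.fin; ∑ s : ρ.Seq, ∏ k ∈ range ρ.K, Real.exp (-(θ * xk P ρ k * (X.vol0c k s : ℝ))))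
      ≤ Real.exp ((X.volTK : ℝ) / m) := by
  letI := ρ.fin
  have hL1 : 1 ≤ (P.L : ℝ) := by linarith
  have hx0 : ∀ k, k ≤ ρ.K → 0 ≤ xk P ρ k := fun k hk =>
    le_trans zero_le_one (one_le_xk P ρ hL1 hε hK1 hk)
  -- the range-product as a `Fin`-product, then the abstract count
  have h1 : ∑ s : ρ.Seq, ∏ k ∈ range ρ.K, Real.exp (-(θ * xk P ρ k * (X.vol0c k s : ℝ)))
      = ∑ s : ρ.Seq, ∏ k : Fin ρ.K, Real.exp (-(θ * xk P ρ k * (X.vol0c k s : ℝ))) :=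
    Finset.sum_congr rfl fun s _ =>
      Finset.prod_range (fun k => Real.exp (-(θ * xk P ρ k * (X.vol0c k s : ℝ))))
  have h2 := sum_prod_exp_le_of_injective ι hι (fun k : Fin ρ.K => θ * xk P ρ k)
    (fun k => mul_nonneg hθ (hx0 k (le_of_lt k.isLt))) m (fun k s => (X.vol0c k s : ℝ)) hv
  -- the scale arithmetic, through block counts extended by zero beyond `K`
  have h3 : ∑ k : Fin ρ.K, (Fintype.card (B k) : ℝ) * Real.exp (-(θ * xk P ρ k * m))
      ≤ (X.volTK : ℝ) / m := by
    have h := blockCount_weight_sum_le P ρ X (m := m) (θ := θ)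
      (fun k => if h : k < ρ.K then (Fintype.card (B ⟨k, h⟩) : ℝ) else 0) hL hε hK1 hm hθm
      (fun k hk => by simp only [dif_pos hk]; exact Nat.cast_nonneg _)
      (fun k hk => by simp only [dif_pos hk]; exact hN ⟨k, hk⟩)
    rw [Finset.sum_range (fun k => (if h : k < ρ.K then (Fintype.card (B ⟨k, h⟩) : ℝ) else 0)
      * Real.exp (-(θ * xk P ρ k * m)))] at h
    refine le_trans (le_of_eq (Finset.sum_congr rfl fun k _ => ?_)) h
    simp only [dif_pos k.isLt, Fin.eta]
  calc ∑ s : ρ.Seq, ∏ k ∈ range ρ.K, Real.exp (-(θ * xk P ρ k * (X.vol0c k s : ℝ)))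
      = _ := h1
    _ ≤ Real.exp (∑ k : Fin ρ.K, (Fintype.card (B k) : ℝ) * Real.exp (-(θ * xk P ρ k * m))) := h2
    _ ≤ Real.exp ((X.volTK : ℝ) / m) := Real.exp_le_exp.mpr h3

end Literature.MathematicalPhysics.QuantumFieldTheory.Balaban1983to89.B2Ineq347SeqCount
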